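import Literature.Computability.AlgebraicComplexity.AndrewsForbes2022PosCharReductions
import Literature.Computability.AlgebraicComplexity.AndrewsForbes2022Prop35Infinite

/-!
# Andrews–Forbes 2022, Theorem 3.8 in characteristic `p` over infinite fields

`AndrewsForbes2022_thm_3_8_posChar_of_infinite`: the positive-characteristic bullet of Thm. 3.8
(typed as `AndrewsForbes2022_thm_3_8_posChar` for all fields of characteristic `p`) PROVED for every
INFINITE field of characteristic `p`, as `AndrewsForbes2022_thm_3_8_posChar_at` (the printed char-`p`
argument, `AndrewsForbes2022PosCharReductions.lean`) fed with `AndrewsForbes2022_prop_3_5_of_infinite`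
(Prop. 3.5 over every infinite field, `AndrewsForbes2022Prop35Infinite.lean`).  Finite fields remain
open (see that file's docstring).  No new named facts.

Honest framing: VP ≠ VNP is NOT proved.

## References
* [AndrewsForbes2022] R. Andrews, M. A. Forbes, STOC 2022, arXiv:2112.00792 — Thm. 3.8 (third bullet),
  Prop. 3.5.
-/

noncomputable section

namespace Literature.Computability.AlgebraicComplexity

/-- **Theorem 3.8, positive characteristic, over every infinite field**: for `char F = p > 0` with `F`
infinite, nonzero `f ∈ I^det_{n,m,r}`, `h = f + O(ε)` and `g` in the border of `r`-vertex layered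
ABPs, some depth-three `h`-oracle circuit computes `g^{p^k} + O(ε)` for some `k`.
(`AndrewsForbes2022_thm_3_8_posChar_at` fed with `AndrewsForbes2022_prop_3_5_of_infinite`.)
[cite: AndrewsForbes2022, Thm. 3.8 (third bullet)] -/
theorem AndrewsForbes2022_thm_3_8_posChar_of_infinite (p : ℕ) [Fact p.Prime] (F : Type) [Field F]
    [CharP F p] [Infinite F] (n m r : ℕ) (f : MvPolynomial (Fin n × Fin m) F)
    (hf : f ∈ detIdeal F n m r) (hf0 : f ≠ 0) (h : MvPolynomial (Fin n × Fin m) (LaurentSeries F))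
    (hh : PolyOrdGE 1 (h - MvPolynomial.map (algebraMap F (LaurentSeries F)) f))
    (ι : Type) (g : MvPolynomial ι F) (hg : InLayeredABPBorder r g) :
    ∃ e : ℕ, DepthThreeOracleComputes h
      (MvPolynomial.map (algebraMap F (LaurentSeries F)) (g ^ p ^ e)) :=
  AndrewsForbes2022_thm_3_8_posChar_at p F
    (fun n m r hr _ f hf hf0 => AndrewsForbes2022_prop_3_5_of_infinite F n m r hr f hf hf0)
    n m r f hf hf0 h hh ι g hg

end Literature.Computability.AlgebraicComplexity
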